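import Summits.Ventures.HSemireg.WedgeHankelRecurrenceBezoutianCauchyIndex
import Literature.LinearAlgebra.QuadraticForm.SignatureTensorProduct
import Literature.LinearAlgebra.QuadraticForm.DicksonInvariant

/-!
# Venture HSemireg — THE EUCLIDEAN RECURSION OF THE CAUCHY INDEX: for real `a ≠ 0`, `m = C·a + r` with `deg r < deg a < deg m` (one step of Euclid's algorithm) and a window containing the real
# roots of `m` and `a`: **`Ind(a/m) = Ind(−r/a) + [deg m − deg a odd]·sign(lc C)`**, `sign(lc C) = sign(lc m · lc a)`; hence the INVERSION FORMULA **`Ind(Q/P) + Ind(P/Q) = [deg P − deg Q odd]·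
# sign(lc P · lc Q)`** (`deg Q < deg P`) and `Ind(−Q/P) = −Ind(Q/P)` — BPR Lemma 9.7 (2) (N147) read through Thm. 9.4 (2) (N150): the Cauchy index itself, with no matrix left in the statement

HONEST FRAMING. Part of the Lean index of the computation cell `pub-hsemireg` (seat p10 gen 36, Sunday typer «UNIFORM-IN-n»).
REAL POLYNOMIALS AND THE TREE'S CAUCHY INDEX ONLY (PROVED Literature `Algebra/Polynomial/CauchyIndex` ∕ `TarskiQuery` — `cauchyIndex`, `cauchyIndex_mod` — imported through N150; the Bezoutian matrices
of N147 ∕ N150 appear in the PROOFS only): no variety, no cohomology theory, no sheaf, no Ext group and no semiregularity map is constructed here; nothing here says that HC / HC_CM / HC_AV holds; no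
Literature fact (unproved `Prop`) is declared or used.  Custodian versions as in `WedgeHankelSiegelIdeal` (1/3).
SOURCE OF THE ARGUMENT (cited; held text read, `book:basu2006-algorithms-real-algebraic-geometry` pp. 66–70, 326–328): S. Basu, R. Pollack, M.-F. Roy, *Algorithms in Real Algebraic Geometry*
(2006) **Lemma 9.7** (the two displayed equalities over one Euclidean step) and **Theorem 9.4** `Sign(Bez(P,Q)) = Ind(Q/P)`; the recursion `Ind(Q/P) = Ind(−R/Q) + …` and the inversion formula
«`Ind(Q/P; a, b) + Ind(P/Q; a, b)` = half the sign change of `PQ`» are BPR §2.4's way of computing the Cauchy index along the signed remainder sequence (Prop. 2.6x / the proof of Thm. 2.58,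
there with general windows; here over a window containing all real roots of both polynomials, so that the boundary term is `[p + q odd]·sign(lc P lc Q)`).  Here: N147 + N150, and `Sign
B(−r, a) = −Sign B(r, a)` (bilinearity, `sigPos (−q) = sigNeg q`).
DEDUP DISCLOSURE (`rg` of the whole tree + Mathlib, 2026-09-01): Literature `CauchyIndex.lean` exposes only `sturmVar_eq_signedRemVar`, `signedRemVar_sub_eq_cauchyIndex` (Thm. 2.58) and
`sturm_general` (48 private lemmas); `TarskiQuery` adds `cauchyIndex_mod`, `tarskiQuery_eq_cauchyIndex`, `tarski`; N150 has `Sign B = Ind`; N147 the Bezoutian step; NO public statement in the tree gives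
the Euclid recursion of `cauchyIndex`, its oddness in the numerator, or the inversion formula — that is this file.  7 names: 0 hits tree-wide.

WHAT IS IN THE TREE (or staged ahead).  N150 **`sign_bezoutian_eq_cauchyIndex`** (`P ≠ 0`, `Q = 0 ∨ deg Q < deg P`, roots of `P` in `(lo, hi)`), `sign_bezoutian_eq_cauchyIndex_mod`; N147
**`sigPos_sub_sigNeg_bezoutian_eq_of_eq_mul_add`** (`p = q + c`, `m = C·a + r`, `deg m ≤ p`, `a ≠ 0`, `deg a = q`, `deg r ≤ q`, `deg C = c`, `C_c ≠ 0`: `Sign B_p(a,m) = Sign B_q(−r,a) + [c odd]·sign C_c`);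
Literature `Bezoutian.bezoutian_smul_left`, `QuadraticForm.sigPos_smul_of_neg'` ∕ `sigNeg_smul_of_neg'`, `DicksonInvariant.toQuadraticForm'_smul`, `TarskiQuery.cauchyIndex_mod`.  Mathlib:
`EuclideanDomain.div_add_mod`, `Polynomial.degree_mod_lt`, `leadingCoeff_add_of_degree_lt`, `natDegree_add_eq_left_of_degree_lt`, `leadingCoeff_mul`, `natDegree_mul`.
THIS FILE (namespace `Summit.Ventures.HSemireg.Wedge.HankelOuter` continued; CHAINED on N150 (hence N149, N147, N146, N145, N142) + Literature `SignatureTensorProduct` ∕ `DicksonInvariant`; 0 definitions):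
* §774 ODDNESS: `sigPos_sigNeg_bezoutian_neg_left` (`sigPos B(−a, m) = sigNeg B(a, m)` and conversely, any linearly ordered field), **`cauchyIndex_neg_right`** (`Ind(−Q/P) = −Ind(Q/P)` for `P ≠ 0`,
  `Q = 0 ∨ deg Q < deg P`, roots of `P` in the window), `cauchyIndex_neg_right_mod` (any `Q`).
* §775 THE EUCLIDEAN STEP: **`cauchyIndex_eq_cauchyIndex_neg_add_of_eq_mul_add`** (`m = C·a + r`, `a ≠ 0`, `r = 0 ∨ deg r < deg a`, `deg a < deg m`, roots of `m` and of `a` in `(lo, hi)`: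
  `Ind(a/m) = Ind(−r/a) + (if deg m − deg a is even then 0 else sign(lc C))`), `sign_leadingCoeff_of_eq_mul_add` (`sign(lc C) = sign(lc m · lc a)`), **`cauchyIndex_eq_cauchyIndex_neg_mod_add`**
  (the same with `C = m / a`, `r = m % a`: `Ind(a/m) = Ind(−(m % a)/a) + [deg m − deg a odd]·sign(lc m · lc a)`).
* §776 THE INVERSION FORMULA: **`cauchyIndex_add_cauchyIndex_swap`** (`deg Q < deg P`, `Q ≠ 0`, roots of `P` and `Q` in `(lo, hi)`: `Ind(Q/P) + Ind(P/Q) = [deg P − deg Q odd]·sign(lc P · lc Q)`).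
CAVEATS.  `ℝ` only; the window `(lo, hi)` must contain ALL real roots of BOTH polynomials (the tree's `cauchyIndex` is windowed; BPR's general-window boundary terms are not typed here); roots in
`cauchyIndex` are the distinct real roots of the denominator.
Nothing Ext-side.  New names only.
-/

open Module Polynomial
open scoped Matrix Polynomial

namespace Summit.Ventures.HSemireg.Wedge.HankelOuter

open Summit.Ventures.HSemireg.Wedge Summit.Ventures.HSemireg.Wedge.Hankel
open Literature.LinearAlgebra.Matrix.Bezoutian (bezoutian bezoutian_smul_left)
open Literature.LinearAlgebra.QuadraticForm (sigPos_smul_of_neg' sigNeg_smul_of_neg')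
open Literature.LinearAlgebra.QuadraticForm.DicksonInvariant (toQuadraticForm'_smul)
open Literature.Algebra.Polynomial (cauchyIndex cauchyIndex_mod)

/-! ## §774. `Ind(−Q/P) = −Ind(Q/P)` -/

section Ordered

variable {K : Type*} [Field K] [LinearOrder K] [IsStrictOrderedRing K]

/-- **`sigPos B(−a, m) = sigNeg B(a, m)` and `sigNeg B(−a, m) = sigPos B(a, m)`** (`B(−a, m) = (−1) • B(a, m)`; any linearly ordered field). [this file, §774] -/
theorem sigPos_sigNeg_bezoutian_neg_left (n : ℕ) (a m : K[X]) :
    sigPos (bezoutian n (-a) m).toQuadraticForm' = sigNeg (bezoutian n a m).toQuadraticForm' ∧ sigNeg (bezoutian n (-a) m).toQuadraticForm' = sigPos (bezoutian n a m).toQuadraticForm' := by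
  have hneg : -a = (-1 : K) • a := by rw [neg_one_smul]
  have h1 : (-1 : K) < 0 := by norm_num
  rw [hneg, bezoutian_smul_left, toQuadraticForm'_smul, sigPos_smul_of_neg' _ h1, sigNeg_smul_of_neg' _ h1]
  exact ⟨rfl, rfl⟩

end Ordered

/-- **`Ind(−Q/P) = −Ind(Q/P)`** for `P ≠ 0`, `Q = 0 ∨ deg Q < deg P` and a window containing the real roots of `P` (both sides are Bezoutian signatures by N150). [this file, §774] -/
theorem cauchyIndex_neg_right (P Q : ℝ[X]) (hP : P ≠ 0) (hPQ : Q = 0 ∨ Q.natDegree < P.natDegree) {lo hi : ℝ} (hroots : ∀ x ∈ P.roots, lo < x ∧ x < hi) :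
    cauchyIndex P (-Q) lo hi = -cauchyIndex P Q lo hi := by
  have hPQ' : -Q = 0 ∨ (-Q).natDegree < P.natDegree := by
    rcases hPQ with h | h
    · exact Or.inl (by rw [h, neg_zero])
    · exact Or.inr (by rwa [natDegree_neg])
  obtain ⟨h1, h2⟩ := sigPos_sigNeg_bezoutian_neg_left (K := ℝ) P.natDegree Q P
  rw [← sign_bezoutian_eq_cauchyIndex P (-Q) hP hPQ' hroots, ← sign_bezoutian_eq_cauchyIndex P Q hP hPQ hroots, h1, h2]
  ring

/-- **`Ind(−Q/P) = −Ind(Q/P)` for ANY `Q`** (`P ≠ 0`, roots of `P` in the window; reduce modulo `P` first, Literature `cauchyIndex_mod`). [this file, §774] -/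
theorem cauchyIndex_neg_right_mod (P Q : ℝ[X]) (hP : P ≠ 0) {lo hi : ℝ} (hroots : ∀ x ∈ P.roots, lo < x ∧ x < hi) :
    cauchyIndex P (-Q) lo hi = -cauchyIndex P Q lo hi := by
  have hQ : Q % P = 0 ∨ (Q % P).natDegree < P.natDegree := by
    by_cases h0 : Q % P = 0
    · exact Or.inl h0
    · exact Or.inr (natDegree_lt_natDegree h0 (degree_mod_lt Q hP))
  have hneg : (-Q) % P = -(Q % P) := by
    have h := EuclideanDomain.div_add_mod (-Q) P
    have h' := EuclideanDomain.div_add_mod Q P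
    -- `(-Q) % P` and `-(Q % P)` both have degree `< deg P` and differ by a multiple of `P`
    have hd : P ∣ (-Q) % P - (-(Q % P)) := ⟨-((-Q) / P) - Q / P, by linear_combination h + h'⟩
    have hlt : ((-Q) % P - (-(Q % P))).degree < P.degree := by
      refine (degree_sub_le _ _).trans_lt (max_lt (degree_mod_lt _ hP) ?_)
      rw [degree_neg]; exact degree_mod_lt _ hP
    exact sub_eq_zero.1 (eq_zero_of_dvd_of_degree_lt hd hlt)
  rw [← cauchyIndex_mod P (-Q), hneg, cauchyIndex_neg_right P (Q % P) hP hQ hroots, cauchyIndex_mod]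

/-! ## §775. One Euclidean step: `Ind(a/m) = Ind(−r/a) + [deg m − deg a odd]·sign(lc C)` -/

/-- `sign(lc C) = sign(lc m · lc a)` when `m = C·a + r` with `deg r < deg (C·a)`, `a ≠ 0`. [bookkeeping] -/
theorem sign_leadingCoeff_of_eq_mul_add {m a C' r : ℝ[X]} (hdiv : m = C' * a + r) (ha : a ≠ 0) (hr : r.degree < (C' * a).degree) :
    SignType.sign C'.leadingCoeff = SignType.sign (m.leadingCoeff * a.leadingCoeff) := by
  have hlc : m.leadingCoeff = C'.leadingCoeff * a.leadingCoeff := by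
    rw [hdiv, add_comm, leadingCoeff_add_of_degree_lt hr, leadingCoeff_mul]
  have ha2 : 0 < a.leadingCoeff * a.leadingCoeff := mul_self_pos.2 (leadingCoeff_ne_zero.2 ha)
  rw [hlc, mul_assoc, sign_mul, sign_pos ha2, mul_one]

/-- **THE EUCLIDEAN STEP OF THE CAUCHY INDEX: for `m = C·a + r` with `a ≠ 0`, `r = 0 ∨ deg r < deg a`, `deg a < deg m`, and a window containing the real roots of `m` AND of `a`,
`Ind(a/m) = Ind(−r/a) + (if deg m − deg a is even then 0 else sign(lc C))`** (N150 twice around N147's Bezoutian step). [this file, §775] -/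
theorem cauchyIndex_eq_cauchyIndex_neg_add_of_eq_mul_add {m a C' r : ℝ[X]} (hdiv : m = C' * a + r) (ha : a ≠ 0) (hr : r = 0 ∨ r.natDegree < a.natDegree) (hdeg : a.natDegree < m.natDegree)
    {lo hi : ℝ} (hm : ∀ x ∈ m.roots, lo < x ∧ x < hi) (ha' : ∀ x ∈ a.roots, lo < x ∧ x < hi) :
    cauchyIndex m a lo hi = cauchyIndex a (-r) lo hi + if Even (m.natDegree - a.natDegree) then 0 else (SignType.sign C'.leadingCoeff : ℤ) := by
  have hm0 : m ≠ 0 := fun h => by rw [h, natDegree_zero] at hdeg; omega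
  have hrq : r.natDegree ≤ a.natDegree := by
    rcases hr with h | h
    · rw [h, natDegree_zero]; exact Nat.zero_le _
    · exact h.le
  -- `C ≠ 0` and `deg C = deg m − deg a`
  have hC0 : C' ≠ 0 := by
    intro h
    rw [h, zero_mul, zero_add] at hdiv
    rw [hdiv] at hdeg
    omega
  have hrlt : r.degree < (C' * a).degree := by
    rw [degree_mul, degree_eq_natDegree hC0, degree_eq_natDegree ha]
    by_cases hr0 : r = 0
    · rw [hr0, degree_zero]; exact_mod_cast WithBot.bot_lt_coe (C'.natDegree + a.natDegree)
    · rw [degree_eq_natDegree hr0]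
      have h : r.natDegree < a.natDegree := hr.resolve_left hr0
      exact_mod_cast (by omega : r.natDegree < C'.natDegree + a.natDegree)
  have hmd : m.natDegree = C'.natDegree + a.natDegree := by
    rw [hdiv, natDegree_add_eq_left_of_degree_lt hrlt, natDegree_mul hC0 ha]
  have hc : C'.natDegree = m.natDegree - a.natDegree := by omega
  have hp : m.natDegree = a.natDegree + (m.natDegree - a.natDegree) := by omega
  have hCc : C'.coeff (m.natDegree - a.natDegree) ≠ 0 := by rw [← hc]; exact leadingCoeff_ne_zero.2 hC0
  have hneg : -r = 0 ∨ (-r).natDegree < a.natDegree := by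
    rcases hr with h | h
    · exact Or.inl (by rw [h, neg_zero])
    · exact Or.inr (by rwa [natDegree_neg])
  have h147 := sigPos_sub_sigNeg_bezoutian_eq_of_eq_mul_add (K := ℝ) hp hdiv le_rfl ha rfl hrq hc hCc
  rw [← sign_bezoutian_eq_cauchyIndex m a hm0 (Or.inr hdeg) hm, ← sign_bezoutian_eq_cauchyIndex a (-r) ha hneg ha', h147, ← hc, coeff_natDegree]

/-- **… with Mathlib's division: `Ind(a/m) = Ind(−(m % a)/a) + [deg m − deg a odd]·sign(lc m · lc a)`** (`a ≠ 0`, `deg a < deg m`, roots of `m` and `a` in the window; `m = (m / a)·a + m % a`,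
`deg (m % a) < deg a`). [this file, §775] -/
theorem cauchyIndex_eq_cauchyIndex_neg_mod_add (m a : ℝ[X]) (ha : a ≠ 0) (hdeg : a.natDegree < m.natDegree) {lo hi : ℝ} (hm : ∀ x ∈ m.roots, lo < x ∧ x < hi) (ha' : ∀ x ∈ a.roots, lo < x ∧ x < hi) :
    cauchyIndex m a lo hi = cauchyIndex a (-(m % a)) lo hi + if Even (m.natDegree - a.natDegree) then 0 else (SignType.sign (m.leadingCoeff * a.leadingCoeff) : ℤ) := by
  have hdiv : m = m / a * a + m % a := by rw [mul_comm]; exact (EuclideanDomain.div_add_mod m a).symm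
  have hr : m % a = 0 ∨ (m % a).natDegree < a.natDegree := by
    by_cases h0 : m % a = 0
    · exact Or.inl h0
    · exact Or.inr (natDegree_lt_natDegree h0 (degree_mod_lt m ha))
  have hm0 : m ≠ 0 := fun h => by rw [h, natDegree_zero] at hdeg; omega
  have hC0 : m / a ≠ 0 := by
    intro h
    rw [h, zero_mul, zero_add] at hdiv
    rcases hr with h' | h'
    · exact hm0 (hdiv.trans h')
    · rw [← hdiv] at h'; omega
  have hrlt : (m % a).degree < (m / a * a).degree := by
    rw [degree_mul, degree_eq_natDegree hC0, degree_eq_natDegree ha]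
    refine (degree_mod_lt m ha).trans_le ?_
    rw [degree_eq_natDegree ha]
    exact_mod_cast Nat.le_add_left _ _
  rw [cauchyIndex_eq_cauchyIndex_neg_add_of_eq_mul_add hdiv ha hr hdeg hm ha', sign_leadingCoeff_of_eq_mul_add hdiv ha hrlt]

/-! ## §776. The inversion formula `Ind(Q/P) + Ind(P/Q) = [deg P − deg Q odd]·sign(lc P · lc Q)` -/

/-- **THE INVERSION FORMULA OF THE CAUCHY INDEX: for `Q ≠ 0`, `deg Q < deg P`, and a window containing the real roots of `P` and of `Q`,
`Ind(Q/P) + Ind(P/Q) = (if deg P − deg Q is even then 0 else sign(lc P · lc Q))`** (`Ind(P/Q) = Ind((P % Q)/Q) = −Ind(−(P % Q)/Q)`, and the Euclidean step). [this file, §776] -/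
theorem cauchyIndex_add_cauchyIndex_swap (P Q : ℝ[X]) (hQ : Q ≠ 0) (hdeg : Q.natDegree < P.natDegree) {lo hi : ℝ} (hP : ∀ x ∈ P.roots, lo < x ∧ x < hi) (hQ' : ∀ x ∈ Q.roots, lo < x ∧ x < hi) :
    cauchyIndex P Q lo hi + cauchyIndex Q P lo hi = if Even (P.natDegree - Q.natDegree) then 0 else (SignType.sign (P.leadingCoeff * Q.leadingCoeff) : ℤ) := by
  rw [cauchyIndex_eq_cauchyIndex_neg_mod_add P Q hQ hdeg hP hQ', cauchyIndex_neg_right_mod Q (P % Q) hQ hQ', cauchyIndex_mod]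
  ring

end Summit.Ventures.HSemireg.Wedge.HankelOuter
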